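import Summits.Ventures.Crystal3D.Theorems.StickyWulffConstantPolycrystalWulffBoundMergingCalculus
import Summits.Ventures.Crystal3D.Theorems.StickyWulffConstantPolycrystalWulffBoundDichotomyArith2
import Summits.Ventures.Crystal3D.Theorems.StickyWulffConstantPolycrystalWulffBoundSeparated
import Summits.Ventures.Crystal3D.Theorems.StickyWulffConstantPolycrystalWulffBoundSameLattice

/-!
# `PolycrystalWulffBound`, line `PolyDensity`: fine twin-free textures, lattice classes up to ONE THIRD

Route `StickyWulffConstant` of the venture `Summits/Ventures/Crystal3D`, crux `PolycrystalWulffBound`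
(item `stmt-Ventures-19482`), second prover lane (poly-p2).  Strengthens `rung_fineTwinFree_classes`
(class volumes `≤ 3/10·Vol`) to class volumes `≤ Vol/3` by adding the SECOND PINCER of P-LINE §3
(«per-grain Wulff with wall over-count ≤ (2√5 − 1)·area», listed there among `rung_twinFree`'s tools)
to the first:

* first pincer:  `En ≥ √3·Per(E) + D/2`  (`freeEnergy_ge_mul_perimeter`; generic walls);
* second pincer: `En ≥ Σ_classes 6·2^{1/3}(√2 v_ℓ)^{2/3} − (√5 − ½)·D`, where `D = Σ_{f,g in different
  classes} ι_B(G f, G g)`: the free energy of a lattice class is that of the MERGED class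
  (`freeEnergy_class_eq_merged`), i.e. `Per_{W_ℓ}(class) − Σ_{g ∉ class} ι_{W_ℓ}(class, G g)`; the
  one-grain Wulff inequality for the merged class (`polycrystalWulffBound_singleGrain`); interfaces are
  additive (`two_iota_biUnion_left`) and `ι_{W} ≤ ι_{B̄(0,√5)} = √5·ι_B` (cross sums monotone,
  `W ⊆ B̄(0,√5)`);
* `second_pincer_arith`: the two together close at class fraction `1/3` (limit of the pair: `0.3503`).

Statement: the crux's `let` vocabulary (TF's binders annotated `: Fin n`), hypotheses `Tex`, `Poly`,
`TF`, and `∀ f, |⋃{G g : A g '' Λ = A f '' Λ}| ≤ Vol/3`.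
WHAT THIS IS NOT: a registered stub; nothing on textures with a lattice class above a third of the
volume or with twins; the crux is not claimed.
-/

noncomputable section

open scoped BigOperators InnerProductSpace ENNReal
open MeasureTheory Filter

namespace Summit.Ventures.Crystal3D.Cruxes.PolycrystalWulffBound.PolyDensity

open Summit.Ventures.Crystal3D.Theorems
open Summit.Ventures.Crystal3D.Cruxes.TextureLiminf.TexShadow (per polytope E3)
open Literature.MathematicalPhysics.StatisticalMechanics (perimeter)

/-- **Fine twin-free textures, lattice classes up to a third of the volume** satisfy the
polycrystal Wulff bound (first + second pincer). -/
theorem rung_fineTwinFree_third :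
    let Λ : Set (EuclideanSpace ℝ (Fin 3)) := Literature.MathematicalPhysics.StatisticalMechanics.fccStacking 1 (Real.sqrt (2 / 3));
    let Brl : (ℤ → ℤ) → Set (EuclideanSpace ℝ (Fin 3)) := Literature.MathematicalPhysics.StatisticalMechanics.barlowStacking 1 (Real.sqrt (2 / 3));
    let Ax : EuclideanSpace ℝ (Fin 3) → (EuclideanSpace ℝ (Fin 3) ≃ₗᵢ[ℝ] EuclideanSpace ℝ (Fin 3)) → (EuclideanSpace ℝ (Fin 3) ≃ₗᵢ[ℝ] EuclideanSpace ℝ (Fin 3)) → Prop := fun m A B => ∃ (L : EuclideanSpace ℝ (Fin 3) ≃ₗᵢ[ℝ] EuclideanSpace ℝ (Fin 3)) (s₁ s₂ : EuclideanSpace ℝ (Fin 3)) (σ σ' : ℤ → ℤ), Literature.MathematicalPhysics.StatisticalMechanics.IsHaggSeq σ ∧ Literature.MathematicalPhysics.StatisticalMechanics.IsHaggSeq σ' ∧ L (EuclideanSpace.single (2 : Fin 3) (1 : ℝ)) = m ∧ A '' Λ ⊆ (fun q => L q + s₁) '' Brl σ ∧ B '' Λ ⊆ (fun q => L q + s₂)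 '' Brl σ';
    let CoAx : (EuclideanSpace ℝ (Fin 3) ≃ₗᵢ[ℝ] EuclideanSpace ℝ (Fin 3)) → (EuclideanSpace ℝ (Fin 3) ≃ₗᵢ[ℝ] EuclideanSpace ℝ (Fin 3)) → Prop := fun A B => ∃ m, Ax m A B;
    let Φ : EuclideanSpace ℝ (Fin 3) → ℝ := fun ν => Real.sqrt 2 / 4 * ∑ᶠ w ∈ {w ∈ Λ | ‖w‖ = 1}, |⟪w, ν⟫_ℝ|;
    let Per : Set (EuclideanSpace ℝ (Fin 3)) → Set (EuclideanSpace ℝ (Fin 3)) → ℝ := fun K S => (⨆ (ξ : EuclideanSpace ℝ (Fin 3) → EuclideanSpace ℝ (Fin 3)) (_ : ContDiff ℝ 1 ξ ∧ HasCompactSupport ξ ∧ ∀ z, ξ z ∈ K), ENNReal.ofReal (∫ z in S, Literature.MathematicalPhysics.StatisticalMechanics.fieldDivergence ξ z)).toReal;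
    let ι : Set (EuclideanSpace ℝ (Fin 3)) → Set (EuclideanSpace ℝ (Fin 3)) → Set (EuclideanSpace ℝ (Fin 3)) → ℝ := fun K S₁ S₂ => (Per K S₁ + Per K S₂ - Per K (S₁ ∪ S₂)) / 2;
    let W : (EuclideanSpace ℝ (Fin 3) ≃ₗᵢ[ℝ] EuclideanSpace ℝ (Fin 3)) → Set (EuclideanSpace ℝ (Fin 3)) := fun A => {y | ∀ ν : EuclideanSpace ℝ (Fin 3), ⟪y, ν⟫_ℝ ≤ Φ (A.symm ν)};
    let Dsc : EuclideanSpace ℝ (Fin 3) → Set (EuclideanSpace ℝ (Fin 3)) := fun m => {y | ‖y‖ ≤ 1 ∧ ⟪y, m⟫_ℝ = 0};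
    let Tex : (n : ℕ) → (Fin n → Set (EuclideanSpace ℝ (Fin 3))) → (Fin n → (EuclideanSpace ℝ (Fin 3) ≃ₗᵢ[ℝ] EuclideanSpace ℝ (Fin 3))) → (Fin n → Fin n → ℝ) → (Fin n → Fin n → EuclideanSpace ℝ (Fin 3)) → Prop := fun n G A c m => (∀ f : Fin n, Literature.MathematicalPhysics.StatisticalMechanics.HasFinitePerimeter (G f) ∧ volume (G f) < ⊤) ∧ (∀ f g, f ≠ g → Disjoint (G f) (G g)) ∧ (∀ f g, f ≠ g → 0 ≤ c f g) ∧ (∀ f g, f ≠ g → ¬ CoAx (A f) (A g) → m f g = 0 ∧ 1 ≤ c f g) ∧ (∀ f g, f ≠ g → CoAx (A f) (A g) → A f '' Λ ≠ A g '' Λ → Ax (m f g) (A f) (A g) ∧ 1 / 2 ≤ c f g);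
    let En : (n : ℕ) → (Fin n → Set (EuclideanSpace ℝ (Fin 3))) → (Fin n → (EuclideanSpace ℝ (Fin 3) ≃ₗᵢ[ℝ] EuclideanSpace ℝ (Fin 3))) → (Fin n → Fin n → ℝ) → (Fin n → Fin n → EuclideanSpace ℝ (Fin 3)) → ℝ := fun n G A c m => ∑ f : Fin n, Per (W (A f)) (G f) - ∑ f, ∑ g, (if f = g then 0 else ι (W (A f)) (G f) (G g)) + ∑ f, ∑ g, (if f = g then 0 else c f g / 2 * ι (Dsc (m f g)) (G f) (G g));
    let Vol : (n : ℕ) → (Fin n → Set (EuclideanSpace ℝ (Fin 3))) → ℝ := fun n G => (volume (⋃ f : Fin n, G f)).toReal;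
    let Poly : Set (EuclideanSpace ℝ (Fin 3)) → Prop := fun S => ∃ (k : ℕ) (H : Fin k → Finset ((EuclideanSpace ℝ (Fin 3)) × ℝ)), S = ⋃ i, ⋂ p ∈ H i, {x | ⟪p.1, x⟫_ℝ < p.2};
    let TF : (n : ℕ) → (Fin n → (EuclideanSpace ℝ (Fin 3) ≃ₗᵢ[ℝ] EuclideanSpace ℝ (Fin 3))) → Prop := fun n A => ∀ f g : Fin n, f ≠ g → CoAx (A f) (A g) → A f '' Λ = A g '' Λ;
    ∀ (n : ℕ) (G : Fin n → Set (EuclideanSpace ℝ (Fin 3))) (A : Fin n → (EuclideanSpace ℝ (Fin 3) ≃ₗᵢ[ℝ] EuclideanSpace ℝ (Fin 3))) (c : Fin n → Fin n → ℝ) (m : Fin n → Fin n → EuclideanSpace ℝ (Fin 3)), Tex n G A c m → (∀ f, Poly (G f)) → TF n A → (∀ f, (volume (⋃ g ∈ {g : Fin n | A g '' Λ = A f '' Λ}, G g)).toReal ≤ 1 / 3 * Vol n G) → 6 * (2 : ℝ) ^ ((1 : ℝ) / 3) * (Real.sqrt 2 * Vol n G) ^ ((2 : ℝ) / 3) ≤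 En n G A c m  := by
  intro Λ Brl Ax CoAx Φ Per ι W Dsc Tex En Vol Poly TF n G A c m hTex hPoly hTF hsmall
  classical
  obtain ⟨hfin, hdisj, hc0, hgen, -⟩ := hTex
  have hvol : ∀ f, volume (G f) < ⊤ := fun f => (hfin f).2
  obtain ⟨hEm, hEv, hEp, hVsum⟩ := texture_union_facts G hfin hdisj
  -- lattice classes
  set lat : Fin n → Set E3 := fun f => A f '' Λ with hlat
  set L : Finset (Set E3) := Finset.univ.image lat with hL
  have hmaps : ∀ f ∈ (Finset.univ : Finset (Fin n)), lat f ∈ L := fun f _ =>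
    Finset.mem_image_of_mem lat (Finset.mem_univ f)
  -- pairs in different classes carry generic walls
  have hwall : ∀ f g, lat f ≠ lat g → m f g = 0 ∧ 1 ≤ c f g := by
    intro f g hne
    have hfg : f ≠ g := fun h => hne (h ▸ rfl)
    exact hgen f g hfg (fun hco => hne (hTF f g hfg hco))
  -- bodies
  have hDsc0 : Dsc 0 = Metric.closedBall (0 : E3) 1 := by
    show {y : E3 | ‖y‖ ≤ 1 ∧ ⟪y, (0 : E3)⟫_ℝ = 0} = Metric.closedBall 0 1
    ext y
    simp [inner_zero_right]
  have hBc : IsCompact (Metric.closedBall (0 : E3) 1) := isCompact_closedBall 0 1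
  have hBv : Convex ℝ (Metric.closedBall (0 : E3) 1) := convex_closedBall 0 1
  have hB0 : (0 : E3) ∈ Metric.closedBall (0 : E3) 1 := Metric.mem_closedBall_self zero_le_one
  have hBs : -Metric.closedBall (0 : E3) 1 = Metric.closedBall 0 1 := by
    rw [neg_closedBall, neg_zero]
  have hB5c : IsCompact (Metric.closedBall (0 : E3) (Real.sqrt 5)) := isCompact_closedBall 0 _
  have hB5v : Convex ℝ (Metric.closedBall (0 : E3) (Real.sqrt 5)) := convex_closedBall 0 _
  have hB50 : (0 : E3) ∈ Metric.closedBall (0 : E3) (Real.sqrt 5) :=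
    Metric.mem_closedBall_self (Real.sqrt_nonneg 5)
  have hDc : ∀ v : E3, IsCompact (Dsc v) := fun v =>
    Metric.isCompact_of_isClosed_isBounded
      ((isClosed_le continuous_norm continuous_const).inter
        (isClosed_eq (continuous_id.inner continuous_const) continuous_const))
      (Metric.isBounded_closedBall.subset (cruxDisc_subset_closedBall v))
  have hWc : ∀ f, IsCompact (W (A f)) := fun f => isCompact_cruxWulffBody (A f)
  have hWv : ∀ f, Convex ℝ (W (A f)) := fun f => convex_cruxWulffBody (A f)
  have hW0 : ∀ f, (0 : E3) ∈ W (A f) := fun f => zero_mem_cruxWulffBody (A f)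
  have hWs : ∀ f, -W (A f) = W (A f) := fun f => neg_cruxWulffBody_eq (A f)
  have hW5 : ∀ f, W (A f) ⊆ Metric.closedBall (0 : E3) (Real.sqrt 5) := fun f =>
    cruxWulffBody_subset_closedBall (A f)
  have hWeq : ∀ f g, lat f = lat g → W (A f) = W (A g) := fun f g h => wulffBody_eq_of_image_eq h
  have hperB : ∀ S : Set E3, per (Metric.closedBall (0 : E3) 1) S = (perimeter S).toReal := fun S => by
    rw [per_closedBall_eq_mul_perimeter one_pos S, one_mul]
  have hperB5 : ∀ S : Set E3, per (Metric.closedBall (0 : E3) (Real.sqrt 5)) S =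
      Real.sqrt 5 * (perimeter S).toReal := fun S =>
    per_closedBall_eq_mul_perimeter (Real.sqrt_pos.2 (by norm_num)) S
  -- one common refinement: every interface term is a cross sum, monotone in the body
  obtain ⟨k, H, ν, S, SX, hcross, -, -⟩ := exists_exterior_crossSums G hPoly hvol hdisj
  have hιW_le : ∀ f g, f ≠ g →
      per (W (A f)) (G f) + per (W (A f)) (G g) - per (W (A f)) (G f ∪ G g) ≤
        Real.sqrt 5 * (per (Metric.closedBall (0 : E3) 1) (G f) +
          per (Metric.closedBall (0 : E3) 1) (G g) - per (Metric.closedBall (0 : E3) 1) (G f ∪ G g)) := by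
    intro f g hfg
    have h1 := hcross (W (A f)) (hWc f) (hWv f) (hW0 f) f g hfg
    have h2 := hcross (Metric.closedBall (0 : E3) (Real.sqrt 5)) hB5c hB5v hB50 f g hfg
    have hmono := crossSum_mono (hW5 f) Metric.isBounded_closedBall ⟨0, hW0 f⟩ H ν (S f) (S g)
    rw [← h1, ← h2, hperB5, hperB5, hperB5] at hmono
    rw [hperB, hperB, hperB]
    linarith
  -- the free energy dominates `√3 · Per(E)` (first pincer)
  have hFr : Real.sqrt 3 * (perimeter (⋃ f, G f)).toReal ≤
      ∑ f, (Per (W (A f)) (G f) - ∑ g, (if f = g then 0 else ι (W (A f)) (G f) (G g))) :=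
    freeEnergy_ge_mul_perimeter G hPoly hvol hdisj (fun f => W (A f)) hWc hWv hW0 hWs
      (Real.sqrt_pos.2 (by norm_num)) (fun f => closedBall_subset_cruxWulffBody (A f))
  -- the unit-ball interface terms `w`
  set w : Fin n → Fin n → ℝ := fun f g => if f = g then 0 else
    (per (Metric.closedBall (0 : E3) 1) (G f) + per (Metric.closedBall (0 : E3) 1) (G g) -
      per (Metric.closedBall (0 : E3) 1) (G f ∪ G g)) / 2 with hw
  have hw0 : ∀ f g, 0 ≤ w f g := by
    intro f g
    by_cases hfg : f = g
    · simp only [hw, hfg, if_true]; exact le_rfl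
    · simp only [hw, hfg, if_false]
      exact div_nonneg (iota_nonneg_of_poly G hPoly hvol hdisj hBc hBv hB0 hfg) zero_le_two
  have hD0 : 0 ≤ ∑ f, ∑ g, (if lat g = lat f then 0 else w f g) :=
    Finset.sum_nonneg fun f _ => Finset.sum_nonneg fun g _ => by
      split_ifs
      · exact le_rfl
      · exact hw0 f g
  -- the wall energy dominates the different-class interface terms (as in `rung_fineTwinFree_classes`)
  have hterm : ∀ f g, (if lat g = lat f then 0 else w f g) ≤
      2 * (if f = g then 0 else c f g / 2 * ι (Dsc (m f g)) (G f) (G g)) := by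
    intro f g
    by_cases hfg : f = g
    · rw [if_pos (by rw [hfg]), if_pos hfg, mul_zero]
    · rw [if_neg hfg]
      by_cases hl : lat g = lat f
      · rw [if_pos hl]
        have hnn := iota_nonneg_of_poly G hPoly hvol hdisj (hDc (m f g)) (convex_cruxDisc (m f g))
          (zero_mem_cruxDisc (m f g)) hfg
        have hc := hc0 f g hfg
        show (0 : ℝ) ≤ 2 * (c f g / 2 * ((per (Dsc (m f g)) (G f) + per (Dsc (m f g)) (G g) -
          per (Dsc (m f g)) (G f ∪ G g)) / 2))
        have : 0 ≤ c f g * (per (Dsc (m f g)) (G f) + per (Dsc (m f g)) (G g) -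
          per (Dsc (m f g)) (G f ∪ G g)) := mul_nonneg hc hnn
        linarith
      · rw [if_neg hl]
        obtain ⟨hm, hc⟩ := hwall f g (fun h => hl h.symm)
        rw [hm, hDsc0]
        have hnn := iota_nonneg_of_poly G hPoly hvol hdisj hBc hBv hB0 hfg
        simp only [hw, hfg, if_false]
        show (per (Metric.closedBall (0 : E3) 1) (G f) + per (Metric.closedBall (0 : E3) 1) (G g) -
            per (Metric.closedBall (0 : E3) 1) (G f ∪ G g)) / 2 ≤
          2 * (c f g / 2 * ((per (Metric.closedBall (0 : E3) 1) (G f) +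
            per (Metric.closedBall (0 : E3) 1) (G g) - per (Metric.closedBall (0 : E3) 1) (G f ∪ G g)) / 2))
        nlinarith
  have hWl : (∑ f, ∑ g, (if lat g = lat f then 0 else w f g)) ≤
      2 * ∑ f, ∑ g, (if f = g then 0 else c f g / 2 * ι (Dsc (m f g)) (G f) (G g)) := by
    have hsum : (∑ f, ∑ g, (if lat g = lat f then 0 else w f g)) ≤
        ∑ f, ∑ g, 2 * (if f = g then 0 else c f g / 2 * ι (Dsc (m f g)) (G f) (G g)) :=
      Finset.sum_le_sum fun f _ => Finset.sum_le_sum fun g _ => hterm f g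
    simp_rw [← Finset.mul_sum] at hsum
    exact hsum
  -- facts on the merged classes
  have hfacts : ∀ ℓ, MeasurableSet (⋃ f ∈ Finset.univ.filter (fun f => lat f = ℓ), G f) ∧
      volume (⋃ f ∈ Finset.univ.filter (fun f => lat f = ℓ), G f) < ⊤ ∧
      perimeter (⋃ f ∈ Finset.univ.filter (fun f => lat f = ℓ), G f) ≠ ⊤ ∧
      (volume (⋃ f ∈ Finset.univ.filter (fun f => lat f = ℓ), G f)).toReal =
        ∑ f ∈ Finset.univ.filter (fun f => lat f = ℓ), (volume (G f)).toReal :=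
    fun ℓ => subfamily_union_facts G hfin hdisj _
  -- SECOND PINCER, class by class
  have hclass : ∀ ℓ ∈ L, 6 * (2 : ℝ) ^ ((1 : ℝ) / 3) *
      (Real.sqrt 2 * (volume (⋃ f ∈ Finset.univ.filter (fun f => lat f = ℓ), G f)).toReal) ^ ((2 : ℝ) / 3) -
      Real.sqrt 5 * (∑ f ∈ Finset.univ.filter (fun f => lat f = ℓ),
        ∑ g, (if lat g = lat f then 0 else w f g)) ≤
      ∑ f ∈ Finset.univ.filter (fun f => lat f = ℓ),
        (per (W (A f)) (G f) - ∑ g, (if f = g then 0 else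
          (per (W (A f)) (G f) + per (W (A f)) (G g) - per (W (A f)) (G f ∪ G g)) / 2)) := by
    intro ℓ hℓ
    obtain ⟨f₀, -, hf₀⟩ := Finset.mem_image.1 hℓ
    set K : Set E3 := W (A f₀) with hK
    have hKf : ∀ f ∈ Finset.univ.filter (fun f => lat f = ℓ), W (A f) = K := fun f hf =>
      hWeq f f₀ (by rw [(Finset.mem_filter.1 hf).2, hf₀])
    have hKc := hWc f₀
    have hKv := hWv f₀
    have hK0 := hW0 f₀
    have hKs := hWs f₀
    -- the class's free energy is that of the merged class
    have hX : (∑ f ∈ Finset.univ.filter (fun f => lat f = ℓ),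
        (per (W (A f)) (G f) - ∑ g, (if f = g then 0 else
          (per (W (A f)) (G f) + per (W (A f)) (G g) - per (W (A f)) (G f ∪ G g)) / 2))) =
        ∑ f ∈ Finset.univ.filter (fun f => lat f = ℓ),
          (per K (G f) - ∑ g, (if f = g then 0 else
            (per K (G f) + per K (G g) - per K (G f ∪ G g)) / 2)) :=
      Finset.sum_congr rfl fun f hf => by rw [hKf f hf]
    rw [hX, freeEnergy_class_eq_merged G hPoly hvol hdisj hKc hKv hK0 hKs _]
    -- one-grain Wulff for the merged class
    have hWulff : 6 * (2 : ℝ) ^ ((1 : ℝ) / 3) *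
        (Real.sqrt 2 * (volume (⋃ f ∈ Finset.univ.filter (fun f => lat f = ℓ), G f)).toReal) ^
          ((2 : ℝ) / 3) ≤ per K (⋃ f ∈ Finset.univ.filter (fun f => lat f = ℓ), G f) :=
      polycrystalWulffBound_singleGrain (A f₀)
        ⟨(hfacts ℓ).1, lt_top_iff_ne_top.2 (hfacts ℓ).2.2.1⟩ (hfacts ℓ).2.1
    -- the over-count of the interfaces of the merged class
    have hover : (∑ g ∈ Finset.univ \ Finset.univ.filter (fun f => lat f = ℓ),
        (per K (⋃ f ∈ Finset.univ.filter (fun f => lat f = ℓ), G f) + per K (G g) -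
          per K ((⋃ f ∈ Finset.univ.filter (fun f => lat f = ℓ), G f) ∪ G g)) / 2) ≤
        Real.sqrt 5 * ∑ f ∈ Finset.univ.filter (fun f => lat f = ℓ),
          ∑ g, (if lat g = lat f then 0 else w f g) := by
      -- interfaces are additive over the class
      have hadd : ∀ g ∈ Finset.univ \ Finset.univ.filter (fun f => lat f = ℓ),
          (per K (⋃ f ∈ Finset.univ.filter (fun f => lat f = ℓ), G f) + per K (G g) -
            per K ((⋃ f ∈ Finset.univ.filter (fun f => lat f = ℓ), G f) ∪ G g)) / 2 ≤
          Real.sqrt 5 * ∑ f ∈ Finset.univ.filter (fun f => lat f = ℓ), w f g := by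
        intro g hg
        have hg' : g ∉ Finset.univ.filter (fun f => lat f = ℓ) := (Finset.mem_sdiff.1 hg).2
        have hlg : lat g ≠ ℓ := fun h => hg' (Finset.mem_filter.2 ⟨Finset.mem_univ g, h⟩)
        rw [two_iota_biUnion_left G hPoly hvol hdisj hKc hKv hK0 hKs hg', Finset.sum_div,
          Finset.mul_sum]
        refine Finset.sum_le_sum fun f hf => ?_
        have hlf : lat f = ℓ := (Finset.mem_filter.1 hf).2
        have hfg : f ≠ g := fun h => hlg (h ▸ hlf)
        have hle := hιW_le f g hfg
        rw [hKf f hf] at hle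
        simp only [hw, hfg, if_false]
        have h5 : (0 : ℝ) ≤ Real.sqrt 5 := Real.sqrt_nonneg 5
        nlinarith
      refine (Finset.sum_le_sum hadd).trans (le_of_eq ?_)
      rw [← Finset.mul_sum, Finset.sum_comm]
      congr 1
      refine Finset.sum_congr rfl fun f hf => ?_
      have hlf : lat f = ℓ := (Finset.mem_filter.1 hf).2
      rw [← Finset.filter_not, Finset.sum_filter]
      refine Finset.sum_congr rfl fun g _ => ?_
      rw [hlf]
      by_cases h : lat g = ℓ
      · rw [if_pos h, if_neg (not_not.2 h)]
      · rw [if_neg h, if_pos h]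
    linarith
  -- sum of the second pincer over the classes
  have hFr2 : (∑ ℓ ∈ L, 6 * (2 : ℝ) ^ ((1 : ℝ) / 3) *
      (Real.sqrt 2 * (volume (⋃ f ∈ Finset.univ.filter (fun f => lat f = ℓ), G f)).toReal) ^ ((2 : ℝ) / 3)) -
      Real.sqrt 5 * (∑ f, ∑ g, (if lat g = lat f then 0 else w f g)) ≤
      ∑ f, (Per (W (A f)) (G f) - ∑ g, (if f = g then 0 else ι (W (A f)) (G f) (G g))) := by
    have hsum := Finset.sum_le_sum hclass
    have e1 : (∑ ℓ ∈ L, Real.sqrt 5 * ∑ f ∈ Finset.univ.filter (fun f => lat f = ℓ),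
        ∑ g, (if lat g = lat f then 0 else w f g)) =
        Real.sqrt 5 * ∑ f, ∑ g, (if lat g = lat f then 0 else w f g) := by
      rw [← Finset.mul_sum, Finset.sum_fiberwise_of_maps_to hmaps]
    have e2 : (∑ ℓ ∈ L, ∑ f ∈ Finset.univ.filter (fun f => lat f = ℓ),
        (per (W (A f)) (G f) - ∑ g, (if f = g then 0 else
          (per (W (A f)) (G f) + per (W (A f)) (G g) - per (W (A f)) (G f ∪ G g)) / 2))) =
        ∑ f, (per (W (A f)) (G f) - ∑ g, (if f = g then 0 else
          (per (W (A f)) (G f) + per (W (A f)) (G g) - per (W (A f)) (G f ∪ G g)) / 2)) :=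
      Finset.sum_fiberwise_of_maps_to hmaps _
    rw [Finset.sum_sub_distrib, e1, e2] at hsum
    exact hsum
  -- volumes of the classes
  have hV : Vol n G = ∑ ℓ ∈ L,
      (volume (⋃ f ∈ Finset.univ.filter (fun f => lat f = ℓ), G f)).toReal := by
    show (volume (⋃ f, G f)).toReal = _
    rw [hVsum, Finset.sum_congr rfl fun ℓ _ => (hfacts ℓ).2.2.2, Finset.sum_fiberwise_of_maps_to hmaps]
  have hsmallL : ∀ ℓ ∈ L, (volume (⋃ f ∈ Finset.univ.filter (fun f => lat f = ℓ), G f)).toReal ≤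
      1 / 3 * Vol n G := by
    intro ℓ hℓ
    obtain ⟨f₀, -, rfl⟩ := Finset.mem_image.1 hℓ
    have hset : (⋃ f ∈ Finset.univ.filter (fun f => lat f = lat f₀), G f) =
        ⋃ g ∈ {g : Fin n | A g '' Λ = A f₀ '' Λ}, G g := by
      ext x
      simp only [Set.mem_iUnion, Finset.mem_filter, Finset.mem_univ, true_and, Set.mem_setOf_eq,
        exists_prop, hlat]
    rw [hset]
    exact hsmall f₀
  -- isoperimetry of the union, and the arithmetic of the two pincers
  have hiso := isoperimetric_toReal_three hEm hEv hEp
  have h1 : Real.sqrt 3 * (perimeter (⋃ f, G f)).toReal +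
      (∑ f, ∑ g, (if lat g = lat f then 0 else w f g)) / 2 ≤
      (∑ f, (Per (W (A f)) (G f) - ∑ g, (if f = g then 0 else ι (W (A f)) (G f) (G g)))) +
        ∑ f, ∑ g, (if f = g then 0 else c f g / 2 * ι (Dsc (m f g)) (G f) (G g)) := by
    linarith
  have h2 : (∑ ℓ ∈ L, 6 * (2 : ℝ) ^ ((1 : ℝ) / 3) *
      (Real.sqrt 2 * (volume (⋃ f ∈ Finset.univ.filter (fun f => lat f = ℓ), G f)).toReal) ^ ((2 : ℝ) / 3)) -
      (Real.sqrt 5 - 1 / 2) * (∑ f, ∑ g, (if lat g = lat f then 0 else w f g)) ≤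
      (∑ f, (Per (W (A f)) (G f) - ∑ g, (if f = g then 0 else ι (W (A f)) (G f) (G g)))) +
        ∑ f, ∑ g, (if f = g then 0 else c f g / 2 * ι (Dsc (m f g)) (G f) (G g)) := by
    linarith
  have harith := second_pincer_arith L isoConst_three_pos (le_of_eq isoConst_three_cube.symm) hV
    (fun ℓ _ => ENNReal.toReal_nonneg) hsmallL hiso hD0 h1 h2
  have hEn : En n G A c m =
      (∑ f, (Per (W (A f)) (G f) - ∑ g, (if f = g then 0 else ι (W (A f)) (G f) (G g)))) +
        ∑ f, ∑ g, (if f = g then 0 else c f g / 2 * ι (Dsc (m f g)) (G f) (G g)) := by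
    show (∑ f, Per (W (A f)) (G f) -
        ∑ f, ∑ g, (if f = g then 0 else ι (W (A f)) (G f) (G g)) +
        ∑ f, ∑ g, (if f = g then 0 else c f g / 2 * ι (Dsc (m f g)) (G f) (G g))) =
      (∑ f, (Per (W (A f)) (G f) - ∑ g, (if f = g then 0 else ι (W (A f)) (G f) (G g)))) +
        ∑ f, ∑ g, (if f = g then 0 else c f g / 2 * ι (Dsc (m f g)) (G f) (G g))
    rw [Finset.sum_sub_distrib]
  rw [hEn]
  exact harith

end Summit.Ventures.Crystal3D.Cruxes.PolycrystalWulffBound.PolyDensity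

end
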